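/-
Origin: expansion seat `planner-pub-hodgecm-pv14-g5-0`, handover #1 2026-08-18T09:39:52Z (`HOME/pub-hodgecm-pv14-g5/lean/Pv14g5/PoissonSummationLattice.lean`, md5 aa0b2c0a, 490 lines);
landed by the gen-7 packager in gate run 27 as `HodgeCM/Automorphic/PoissonSummationLattice.lean` (verbatim).
-/
import Mathlib.Analysis.Fourier.AddCircleMulti
import Mathlib.Analysis.Distribution.SchwartzSpace.Fourier
import Mathlib.Algebra.Module.ZLattice.Covolume
import Mathlib.LinearAlgebra.BilinearForm.DualLattice
import Summits.HodgeConjecture.HodgeCM.PerL34.LatticeTheta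

/-!
# Poisson summation over a full `ℤ`-lattice in a finite-dimensional real inner product space
(KERNEL, Mathlib + `HodgeCM.PerL34.LatticeTheta` only)

Unit `pub-hodgecm-pv14-g5` (DAG node #14 lineage, gen 5).  Proposed final place:
`HodgeCM/Automorphic/PoissonSummationLattice.lean`.

## What this file makes KERNEL

Mathlib has the Poisson summation formula only in dimension one, for the lattice `ℤ ⊂ ℝ`
(`Real.tsum_eq_tsum_fourier`, `SchwartzMap.tsum_eq_tsum_fourier`).  The archimedean theta
machinery of this package (the Schrödinger–lattice Weil model of unit #14, the seesaw shell of
N17, the print input `X2b_theta_poisson` of `HodgeCM.PerL34.SiegelWeil`) needs it for a full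
lattice `L` of arbitrary rank `d` (GAPS.md `pv14g4-K1` addendum 1, obstruction (c)).  We prove,
from Mathlib alone (plus the lattice-theta summability file `LatticeTheta` of unit #11):

* `dualLattice L` — the dual lattice `L* = {w | ⟪w, v⟫ ∈ ℤ ∀ v ∈ L}` w.r.t. the inner product,
  with `DiscreteTopology` / `IsZLattice` instances and a `ℤ`-basis `dualZBasis` dual to a
  `ℤ`-basis of `L`;
* `hasSum_fourier_dualLattice` — for a Schwartz function `Φ : 𝓢(V, ℂ)` and `x : V`,
  `HasSum (fun w : L* ↦ 𝓕 Φ w * 𝐞 ⟪w, x⟫) (covol(L) * ∑_{v ∈ L} Φ (x + v))`;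
* `tsum_lattice_eq_tsum_dualLattice` — **Poisson summation**
  `∑_{v ∈ L} Φ (x + v) = covol(L)⁻¹ * ∑_{w ∈ L*} 𝓕 Φ (w) * 𝐞 ⟪w, x⟫`;
* `tsum_lattice_eq_tsum_dualLattice_zero` — the `x = 0` case
  `∑_{v ∈ L} Φ v = covol(L)⁻¹ * ∑_{w ∈ L*} 𝓕 Φ w`.

Conventions are Mathlib's: `𝓕 Φ w = ∫ v, 𝐞 (-⟪v, w⟫) • Φ v`, `𝐞 t = exp (2π i t)`, `volume` on
`V` is the Haar measure normalised by the inner product, `ZLattice.covolume L` the volume of a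
fundamental domain.

Method: coordinates w.r.t. a `ℤ`-basis `b` of `L` identify `V/L` with the torus `(ℝ/ℤ)^ι`;
the periodisation of `Φ` descends to a continuous function there whose multivariate Fourier
coefficients (`UnitAddTorus.mFourierCoeff`) are computed by unfolding over the `ZSpan`
fundamental domain (`IsAddFundamentalDomain.integral_eq_tsum''`) and the Haar change of
variables `map (equivFun) volume = covol(L) • volume`; they are `covol(L)⁻¹ * 𝓕 Φ` at the
dual-lattice points, a summable family since `𝓕 Φ` is Schwartz, so
`UnitAddTorus.hasSum_mFourier_series_apply_of_summable` applies.

No statement of the 2001 programme, of PerL or of QW8 is used or cited.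
-/

set_option autoImplicit false

noncomputable section

open MeasureTheory MeasureTheory.Measure Module Submodule Set ZSpan
open scoped RealInnerProductSpace FourierTransform

namespace HodgeCM
namespace PoissonSummation

/-! ### The dual lattice -/

section Dual

variable {V : Type*} [NormedAddCommGroup V] [InnerProductSpace ℝ V]

/-- (Ported verbatim from the HodgeCMPerL package; no docstring in the source.) -/
theorem innerₗ_nondegenerate : (innerₗ V).Nondegenerate :=
  ⟨fun x hx => inner_self_eq_zero.mp (hx x), fun y hy => inner_self_eq_zero.mp (hy y)⟩

/-- The dual lattice `L* = {w | ⟪w, v⟫ ∈ ℤ for all v ∈ L}` of a `ℤ`-submodule `L` of a real inner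
product space (the dual submodule for the bilinear form `innerₗ V`). -/
def dualLattice (L : Submodule ℤ V) : Submodule ℤ V :=
  LinearMap.BilinForm.dualSubmodule (innerₗ V) L

/-- (Ported verbatim from the HodgeCMPerL package; no docstring in the source.) -/
theorem mem_dualLattice {L : Submodule ℤ V} {w : V} :
    w ∈ dualLattice L ↔ ∀ v ∈ L, ∃ m : ℤ, (m : ℝ) = ⟪w, v⟫ := by
  simp [dualLattice, LinearMap.BilinForm.mem_dualSubmodule, Submodule.mem_one]

variable [FiniteDimensional ℝ V]
variable (L : Submodule ℤ V) [DiscreteTopology L] [IsZLattice ℝ L]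
variable {ι : Type*} [Fintype ι] [DecidableEq ι] (b : Basis ι ℤ L)

/-- The real basis of `V` underlying a `ℤ`-basis `b` of the full lattice `L`. -/
abbrev realBasis : Basis ι ℝ V := b.ofZLatticeBasis ℝ L

/-- The basis of `V` dual to `realBasis L b` under the inner product. -/
def dualBasis : Basis ι ℝ V :=
  LinearMap.BilinForm.dualBasis (innerₗ V) innerₗ_nondegenerate (realBasis L b)

/-- (Ported verbatim from the HodgeCMPerL package; no docstring in the source.) -/
theorem inner_dualBasis_realBasis (i j : ι) :
    ⟪dualBasis L b i, realBasis L b j⟫ = if j = i then 1 else 0 :=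
  LinearMap.BilinForm.apply_dualBasis_left innerₗ_nondegenerate (realBasis L b) i j

/-- The `i`-th coordinate of `y` in `realBasis L b` is `⟪dualBasis L b i, y⟫`. -/
theorem realBasis_repr_eq_inner (y : V) (i : ι) :
    (realBasis L b).repr y i = ⟪dualBasis L b i, y⟫ := by
  conv_rhs => rw [← (realBasis L b).sum_repr y]
  rw [inner_sum]
  simp_rw [real_inner_smul_right, inner_dualBasis_realBasis, mul_ite, mul_one, mul_zero,
    Finset.sum_ite_eq' Finset.univ, if_pos (Finset.mem_univ _)]

/-- (Ported verbatim from the HodgeCMPerL package; no docstring in the source.) -/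
theorem dualLattice_eq_span : dualLattice L = span ℤ (Set.range (dualBasis L b)) := by
  rw [dualLattice, dualBasis, ← LinearMap.BilinForm.dualSubmodule_span_of_basis,
    Basis.ofZLatticeBasis_span]

/-- (Ported verbatim from the HodgeCMPerL package; no docstring in the source.) -/
instance instDiscreteTopologyDualLattice : DiscreteTopology (dualLattice L) := by
  classical
  rw [dualLattice_eq_span L (Module.Free.chooseBasis ℤ L)]
  infer_instance

/-- (Ported verbatim from the HodgeCMPerL package; no docstring in the source.) -/
instance instIsZLatticeDualLattice : IsZLattice ℝ (dualLattice L) := by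
  classical
  refine ⟨?_⟩
  rw [dualLattice_eq_span L (Module.Free.chooseBasis ℤ L)]
  exact ZSpan.span_top _

/-- The `ℤ`-basis of the dual lattice dual to `b`. -/
def dualZBasis : Basis ι ℤ (dualLattice L) :=
  ((dualBasis L b).restrictScalars ℤ).map (LinearEquiv.ofEq _ _ (dualLattice_eq_span L b).symm)

/-- (Ported verbatim from the HodgeCMPerL package; no docstring in the source.) -/
@[simp] theorem coe_dualZBasis (i : ι) : (dualZBasis L b i : V) = dualBasis L b i := by
  simp [dualZBasis, Basis.map_apply, LinearEquiv.coe_ofEq_apply, Basis.restrictScalars_apply]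

/-- Integer coordinates on the dual lattice: `n ↦ ∑ i, n i • dualZBasis L b i`. -/
def dualLatticeEquiv : (ι → ℤ) ≃ₗ[ℤ] dualLattice L := (dualZBasis L b).equivFun.symm

/-- (Ported verbatim from the HodgeCMPerL package; no docstring in the source.) -/
theorem coe_dualLatticeEquiv (n : ι → ℤ) :
    (dualLatticeEquiv L b n : V) = ∑ i, (n i : ℝ) • dualBasis L b i := by
  rw [dualLatticeEquiv, Basis.equivFun_symm_apply, Submodule.coe_sum]
  exact Finset.sum_congr rfl fun i _ => by
    rw [Submodule.coe_smul_of_tower, coe_dualZBasis, Int.cast_smul_eq_zsmul]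

/-- `⟪w_n, y⟫ = ∑ i, n i * (i-th coordinate of y)`. -/
theorem inner_dualLatticeEquiv (n : ι → ℤ) (y : V) :
    ⟪(dualLatticeEquiv L b n : V), y⟫ = ∑ i, (n i : ℝ) * (realBasis L b).repr y i := by
  rw [coe_dualLatticeEquiv, sum_inner]
  simp_rw [real_inner_smul_left, realBasis_repr_eq_inner]

omit [FiniteDimensional ℝ V] [DiscreteTopology L] [IsZLattice ℝ L] in
/-- The pairing of the lattice with its dual is integral. -/
theorem exists_int_eq_inner (w : dualLattice L) (v : L) : ∃ m : ℤ, (m : ℝ) = ⟪(w : V), (v : V)⟫ :=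
  (mem_dualLattice.mp w.2) v v.2

end Dual

/-! ### The torus `(ℝ/ℤ)^ι` and coordinates -/

section Torus

variable {ι : Type*}

/-- The projection `ℝ^ι → (ℝ/ℤ)^ι`. -/
def toTorus (s : ι → ℝ) : UnitAddTorus ι := fun i => (s i : UnitAddCircle)

/-- (Ported verbatim from the HodgeCMPerL package; no docstring in the source.) -/
theorem isOpenQuotientMap_toTorus : IsOpenQuotientMap (toTorus (ι := ι)) :=
  IsOpenQuotientMap.piMap fun _ => QuotientAddGroup.isOpenQuotientMap_mk

/-- (Ported verbatim from the HodgeCMPerL package; no docstring in the source.) -/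
theorem exists_int_of_toTorus_eq {s s' : ι → ℝ} (h : toTorus s = toTorus s') :
    ∃ m : ι → ℤ, s = s' + fun i => (m i : ℝ) := by
  have h' : ∀ i, ∃ m : ℤ, s i = s' i + m := fun i => by
    have hi := congr_fun h i
    simp only [toTorus] at hi
    rw [QuotientAddGroup.eq_iff_sub_mem, AddSubgroup.mem_zmultiples_iff] at hi
    obtain ⟨k, hk⟩ := hi
    rw [zsmul_one] at hk
    exact ⟨k, by linarith⟩
  choose m hm using h'
  exact ⟨m, funext hm⟩

/-- `𝐞` is trivial on integers. -/
theorem fourierChar_intCast (m : ℤ) : Real.fourierChar (m : ℝ) = 1 := by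
  rw [Real.fourierChar_apply']
  exact Circle.exp_two_pi_mul_int m

/-- (Ported verbatim from the HodgeCMPerL package; no docstring in the source.) -/
theorem continuous_fourierChar_neg_inner {V : Type*} [NormedAddCommGroup V]
    [InnerProductSpace ℝ V] (w : V) :
    Continuous fun y : V => (Real.fourierChar (-⟪y, w⟫) : ℂ) := by
  simp only [Real.fourierChar_apply]
  fun_prop

end Torus

/-! ### Periodisation of a Schwartz function and its descent to the torus -/

section Periodization

variable {V : Type*} [NormedAddCommGroup V] [InnerProductSpace ℝ V] [FiniteDimensional ℝ V]
variable (L : Submodule ℤ V) [DiscreteTopology L] [IsZLattice ℝ L]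
variable {ι : Type*} [Fintype ι] [DecidableEq ι] (b : Basis ι ℤ L)
variable (Φ : SchwartzMap V ℂ)

/-- The periodisation `x ↦ ∑_{v ∈ L} Φ (x + v)` (absolutely convergent, `LatticeTheta` T1). -/
def periodization (x : V) : ℂ := ∑' v : L, Φ (x + (v : V))

omit [FiniteDimensional ℝ V] [DiscreteTopology L] [IsZLattice ℝ L] in
/-- (Ported verbatim from the HodgeCMPerL package; no docstring in the source.) -/
theorem periodization_add_coe (x : V) (v : L) :
    periodization L Φ (x + (v : V)) = periodization L Φ x :=
  PerL34.LatticeTheta.tsum_translate_add_mem L Φ x v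

omit [IsZLattice ℝ L] in
/-- (Ported verbatim from the HodgeCMPerL package; no docstring in the source.) -/
theorem continuous_periodization : Continuous (periodization L Φ) :=
  PerL34.LatticeTheta.continuous_tsum_translate L Φ

omit [DecidableEq ι] in
/-- (Ported verbatim from the HodgeCMPerL package; no docstring in the source.) -/
theorem equivFunL_symm_apply (s : ι → ℝ) :
    (realBasis L b).equivFunL.symm s = ∑ i, s i • realBasis L b i := by
  change (realBasis L b).equivFun.symm s = _
  exact Basis.equivFun_symm_apply _ _

omit [DecidableEq ι] in
/-- An integer coordinate vector is a lattice vector. -/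
theorem equivFunL_symm_intCast (m : ι → ℤ) :
    (realBasis L b).equivFunL.symm (fun i => (m i : ℝ)) = ((∑ i, m i • b i : L) : V) := by
  rw [equivFunL_symm_apply, Submodule.coe_sum]
  exact Finset.sum_congr rfl fun i _ => by
    rw [Submodule.coe_smul_of_tower, Basis.ofZLatticeBasis_apply, Int.cast_smul_eq_zsmul]

/-- The periodisation in coordinates is `ℤ^ι`-periodic, hence descends to the torus; we realise the
descent through an arbitrary section of `toTorus`. -/
def torusFun (t : UnitAddTorus ι) : ℂ :=
  periodization L Φ ((realBasis L b).equivFunL.symm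
    (Function.surjInv (isOpenQuotientMap_toTorus (ι := ι)).surjective t))

omit [DecidableEq ι] in
/-- (Ported verbatim from the HodgeCMPerL package; no docstring in the source.) -/
theorem torusFun_toTorus (s : ι → ℝ) :
    torusFun L b Φ (toTorus s) = periodization L Φ ((realBasis L b).equivFunL.symm s) := by
  obtain ⟨m, hm⟩ := exists_int_of_toTorus_eq
    (Function.surjInv_eq (isOpenQuotientMap_toTorus (ι := ι)).surjective (toTorus s))
  rw [torusFun, hm, map_add, equivFunL_symm_intCast, periodization_add_coe]

/-- The periodisation of `Φ`, in the coordinates of `b`, as a continuous function on `(ℝ/ℤ)^ι`. -/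
def torusMap : C(UnitAddTorus ι, ℂ) where
  toFun := torusFun L b Φ
  continuous_toFun := by
    rw [← (isOpenQuotientMap_toTorus (ι := ι)).continuous_comp_iff]
    have : torusFun L b Φ ∘ toTorus = fun s => periodization L Φ ((realBasis L b).equivFunL.symm s) :=
      funext fun s => torusFun_toTorus L b Φ s
    rw [this]
    exact (continuous_periodization L Φ).comp (realBasis L b).equivFunL.symm.continuous

omit [DecidableEq ι] in
/-- (Ported verbatim from the HodgeCMPerL package; no docstring in the source.) -/
@[simp] theorem torusMap_toTorus (s : ι → ℝ) :
    torusMap L b Φ (toTorus s) = periodization L Φ ((realBasis L b).equivFunL.symm s) :=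
  torusFun_toTorus L b Φ s

/-! ### Characters: the torus monomials in lattice coordinates are `𝐞 ⟪w_n, ·⟫` -/

/-- (Ported verbatim from the HodgeCMPerL package; no docstring in the source.) -/
theorem mFourier_toTorus (n : ι → ℤ) (y : V) :
    UnitAddTorus.mFourier n (toTorus ((realBasis L b).equivFunL y)) =
      (Real.fourierChar ⟪(dualLatticeEquiv L b n : V), y⟫ : ℂ) := by
  simp only [UnitAddTorus.mFourier, ContinuousMap.coe_mk, toTorus, fourier_coe_apply,
    Real.fourierChar_apply, ← Complex.exp_sum, inner_dualLatticeEquiv, Basis.equivFunL_apply]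
  congr 1
  push_cast
  rw [Finset.mul_sum, Finset.sum_mul]
  exact Finset.sum_congr rfl fun i _ => by ring

/-! ### Haar change of variables: `map (coordinates) volume = covol(L) • volume` -/

/-- (Ported verbatim from the HodgeCMPerL package; no docstring in the source.) -/
theorem map_equivFunL_volume [MeasurableSpace V] [BorelSpace V] :
    Measure.map (realBasis L b).equivFunL (volume : Measure V) =
      ENNReal.ofReal (ZLattice.covolume L) • (volume : Measure (ι → ℝ)) := by
  set B := realBasis L b
  have h1 : (volume : Measure V) = volume (B.parallelepiped : Set V) • B.addHaar := by
    rw [Basis.addHaar_def]; exact addHaarMeasure_unique volume B.parallelepiped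
  have h2 : B.map B.equivFunL.toLinearEquiv = Pi.basisFun ℝ ι := by
    refine Basis.eq_of_apply_eq fun i => ?_
    rw [Basis.map_apply, Pi.basisFun_apply, ContinuousLinearEquiv.coe_toLinearEquiv]
    funext j
    rw [Basis.equivFunL_apply, Basis.repr_self, Finsupp.single_eq_pi_single]
  have h3 : Measure.map B.equivFunL B.addHaar = volume := by
    rw [Basis.map_addHaar, h2, Basis.addHaar_def, Basis.parallelepiped_basisFun,
      addHaarMeasure_eq_volume_pi]
  have h4 : volume (B.parallelepiped : Set V) = ENNReal.ofReal (ZLattice.covolume L) := by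
    rw [Basis.coe_parallelepiped, ← measure_congr (fundamentalDomain_ae_parallelepiped B volume),
      ZLattice.covolume_eq_measure_fundamentalDomain L volume (ZLattice.isAddFundamentalDomain b volume),
      measureReal_def, ENNReal.ofReal_toReal]
    exact (ZSpan.fundamentalDomain_isBounded B).measure_lt_top.ne
  conv_lhs => rw [h1]
  rw [Measure.map_smul, h3, h4]

/-- Change of variables to lattice coordinates, with the covolume as Jacobian. -/
theorem covolume_smul_setIntegral_eq [MeasurableSpace V] [BorelSpace V]
    {E : Type*} [NormedAddCommGroup E] [NormedSpace ℝ E] (g : (ι → ℝ) → E) (Q : Set (ι → ℝ)) :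
    ZLattice.covolume L • ∫ s in Q, g s =
      ∫ y in (realBasis L b).equivFunL ⁻¹' Q, g ((realBasis L b).equivFunL y) := by
  set c := (realBasis L b).equivFunL
  have h := setIntegral_map_equiv (μ := (volume : Measure V)) c.toHomeomorph.toMeasurableEquiv g Q
  simp only [Homeomorph.toMeasurableEquiv_coe, ContinuousLinearEquiv.coe_toHomeomorph] at h
  rw [← h, map_equivFunL_volume, Measure.restrict_smul, integral_smul_measure,
    ENNReal.toReal_ofReal (ZLattice.covolume_pos L volume).le]

omit [DecidableEq ι] in
/-- (Ported verbatim from the HodgeCMPerL package; no docstring in the source.) -/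
theorem preimage_equivFunL_pi_Ico :
    (realBasis L b).equivFunL ⁻¹' (Set.univ.pi fun _ => Set.Ico (0 : ℝ) 1) =
      fundamentalDomain (realBasis L b) := by
  ext y
  simp [ZSpan.mem_fundamentalDomain, Basis.equivFunL_apply]

/-! ### The Fourier coefficients of the periodisation -/

section Coeff

variable [MeasurableSpace V] [BorelSpace V]

omit [DecidableEq ι] in
/-- Unfolding: the integral of `𝐞(-⟪·, w⟫) · (periodisation of Φ)` over a fundamental domain is
`𝓕 Φ w`, for `w` in the dual lattice. -/
theorem setIntegral_fundamentalDomain_fourierChar_mul_periodization (w : dualLattice L) :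
    ∫ y in fundamentalDomain (realBasis L b),
        (Real.fourierChar (-⟪y, (w : V)⟫) : ℂ) * periodization L Φ y = 𝓕 Φ (w : V) := by
  have hFD : IsAddFundamentalDomain L (fundamentalDomain (realBasis L b)) volume :=
    ZLattice.isAddFundamentalDomain b volume
  have : MeasurableVAdd L V := (inferInstance : MeasurableVAdd L.toAddSubgroup V)
  have : VAddInvariantMeasure L V volume :=
    (inferInstance : VAddInvariantMeasure L.toAddSubgroup V volume)
  -- the character is `L`-invariant in the first variable against dual-lattice vectors
  have hchar : ∀ (v : L) (y : V),
      (Real.fourierChar (-⟪(v : V) + y, (w : V)⟫) : ℂ) = Real.fourierChar (-⟪y, (w : V)⟫) := by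
    intro v y
    obtain ⟨m, hm⟩ := exists_int_eq_inner L w v
    rw [inner_add_left, real_inner_comm, ← hm, neg_add, AddChar.map_add_eq_mul, Circle.coe_mul,
      ← Int.cast_neg, fourierChar_intCast, Circle.coe_one, one_mul]
  -- integrability of the Fourier integrand
  have hint : Integrable (fun y : V => (Real.fourierChar (-⟪y, (w : V)⟫) : ℂ) * Φ y) volume := by
    have := (Real.fourierIntegral_convergent_iff (μ := volume) (f := (Φ : V → ℂ)) (w : V)).2
      Φ.integrable
    simpa only [Circle.smul_def, smul_eq_mul] using this
  have hmeas : MeasurableSet (fundamentalDomain (realBasis L b)) :=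
    fundamentalDomain_measurableSet _
  calc ∫ y in fundamentalDomain (realBasis L b),
        (Real.fourierChar (-⟪y, (w : V)⟫) : ℂ) * periodization L Φ y
      = ∫ y in fundamentalDomain (realBasis L b),
          ∑' v : L, (Real.fourierChar (-⟪y, (w : V)⟫) : ℂ) * Φ (y + (v : V)) := by
        refine setIntegral_congr_fun hmeas fun y _ => ?_
        exact tsum_mul_left.symm
    _ = ∑' v : L, ∫ y in fundamentalDomain (realBasis L b),
          (Real.fourierChar (-⟪y, (w : V)⟫) : ℂ) * Φ (y + (v : V)) := by
        refine integral_tsum (fun v => ?_) ?_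
        · exact ((continuous_fourierChar_neg_inner (w : V)).mul
            (Φ.continuous.comp (continuous_id.add continuous_const))).aestronglyMeasurable
        · have hn : ∀ (v : L) (y : V),
              ‖(Real.fourierChar (-⟪y, (w : V)⟫) : ℂ) * Φ (y + (v : V))‖ₑ = ‖Φ (v +ᵥ y)‖ₑ := by
            intro v y
            rw [enorm_mul, ← ofReal_norm (Real.fourierChar _ : ℂ), Circle.norm_coe,
              ENNReal.ofReal_one, one_mul, Submodule.vadd_def, vadd_eq_add, add_comm]
          simp_rw [hn]
          rw [← hFD.lintegral_eq_tsum'' fun y => ‖Φ y‖ₑ]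
          exact ne_of_lt Φ.integrable.2
    _ = ∑' v : L, ∫ y in fundamentalDomain (realBasis L b),
          (fun y => (Real.fourierChar (-⟪y, (w : V)⟫) : ℂ) * Φ y) (v +ᵥ y) := by
        refine tsum_congr fun v => setIntegral_congr_fun hmeas fun y _ => ?_
        simp only [Submodule.vadd_def, vadd_eq_add]
        rw [hchar v y, add_comm]
    _ = ∫ y, (Real.fourierChar (-⟪y, (w : V)⟫) : ℂ) * Φ y := (hFD.integral_eq_tsum'' _ hint).symm
    _ = 𝓕 Φ (w : V) := by
        rw [SchwartzMap.fourier_coe, Real.fourier_eq]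
        simp only [Circle.smul_def, smul_eq_mul]


-- port_pkg: scope closed for this part
end Coeff
end Periodization
end PoissonSummation
end HodgeCM
end
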